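import Summits.ResolutionOfSingularities.ResolutionOfSingularities.Theorems.FrobeniusClosingPatchingRelPerfectMonomialPairBookkeeping
import HarnessLib

/-!
# Crux `PatchingRelPerfect` (stmt-ResolutionOfSingularities-16161), chain w52 — R4 support:
# PRINCIPALIZATION OF A PAIR OF MONOMIAL IDEALS, part 2 (the blow-up step)

[OURS · L1 W5.2 · R4 support «monomial cleanup»] One step of the principalization of
`monomialIdeal A ⊔ monomialIdeal B` (part 1: `…MonomialPairBookkeeping.lean`): blow up the stratum
`V(K) ∩ V(L)` of a bad pair `(K, L)` chosen with `a_K − b_K = M := maxVal A B` and `b_L − a_L` maximal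
among the bad partners of `K`.  PROVED:

* `expOf_transformExp_comap`, `expOf_transformExp_strictTransform` — the exponents of the exceptional
  divisor (`∑_T a − m`) and of a strict transform (unchanged) in `transformExp E π T m`, at any of their
  points (via `weightOf_transformExp`, `pre`, `strictTransformIdeal_ne_comap`,
  `eq_of_strictTransformIdeal_eq` of `MonomialOrderReduction.lean` / `MonomialMarkedIdealsBlowup.lean`);
  `comap_monomialIdeal_eq_transformExp` — the total transform is `monomialIdeal (transformExp E π T 0)`;
* **`step_classify`** — after the blow-up, every bad pair has value `< M` or is the pair of strict
  transforms of an old bad pair `≠ (K, L)` with the same value: the exceptional divisor `F` has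
  `δ_F = δ_K + δ_L ∈ [0, M)`, the strict transforms of `K`, `L` are disjoint
  (`exists_not_mem_support_strictTransformIdeal`), and a bad pair `(F, H')` forces
  `V(K) ∩ V(L) ∩ V(H) ≠ ∅`, so `H` was a bad partner of `K` and `|δ_H| ≤ |δ_L|`;
* **`exists_step`** — hence blowing up the chosen stratum (regular, inside the cosupport, snc boundary
  preserved: `HasSNC.isRegular_subscheme_finsetSup`, `hasSNC_boundaryOf_transformExp`) makes the
  measure `(maxVal, numMax)` drop lexicographically.

The induction is `…MonomialPairPrincipalization.lean`.  Fact-free, any dimension; nothing here is a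
statement of the manuscript under review.

## References

* J. Kollár, *Lectures on Resolution of Singularities* (2007), (3.111) Step 3, Def. 3.25. [Kollar2007]
* R. Goward, *A simple algorithm for principalization of monomial ideals*, Trans. AMS 357 (2005),
  §2. [Goward2005]
-/

-- `Summit.<Summit>.<Sub>.Theorems` with `Sub = Summit` (single-conjunct summit, D-0017)
set_option linter.dupNamespace false

noncomputable section

open CategoryTheory AlgebraicGeometry TopologicalSpace IsLocalRing
open Literature.AlgebraicGeometry.Resolution

namespace Summit.ResolutionOfSingularities.ResolutionOfSingularities.Theorems

namespace MonomialCleanup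

universe u

/-! ## Exponents after blowing up a stratum -/

section Exponents

variable {X X' : Scheme.{u}} [IsLocallyNoetherian X] {π : X' ⟶ X}
  {E : List (X.IdealSheafData × ℕ)} {T : Finset X.IdealSheafData} {m : ℕ}
  (hE : HasSNC (boundaryOf E)) (hT : ∀ K ∈ T, K ∈ boundaryOf E) (hπ : IsBlowup π (T.sup id))
include hE hT hπ

/-- Over a point of the exceptional divisor no old divisor has the exceptional divisor as its strict
transform. [folklore] -/
theorem pre_singleton_comap {x' : X'} (hx' : x' ∈ ((T.sup id).comap π).support) :
    pre E π T {(T.sup id).comap π} = ∅ := by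
  ext K
  simp only [mem_pre_iff, Finset.mem_singleton, Finset.notMem_empty, iff_false, not_and]
  exact fun hK h => strictTransformIdeal_ne_comap hE hT hπ (mem_sheaves_iff.mp hK) hx' h

/-- **The exponent of the exceptional divisor** (at any of its points): `∑_{K ∈ T} a_K − m`.
[cite: Kollar2007, (3.111) Step 3] -/
theorem expOf_transformExp_comap {x' : X'} (hx' : x' ∈ ((T.sup id).comap π).support) :
    expOf (transformExp E π T m) ((T.sup id).comap π) = weightOf E T - m := by
  classical
  rw [expOf, weightOf_transformExp, pre_singleton_comap hE hT hπ hx', weightOf_empty,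
    if_pos (Finset.mem_singleton_self _), zero_add]

/-- Behind a strict transform with a point there is exactly one old divisor. [folklore] -/
theorem pre_singleton_strictTransform {K₀ : X.IdealSheafData} (hK₀ : K₀ ∈ sheaves E) {x' : X'}
    (hx' : x' ∈ (strictTransformIdeal π (T.sup id) K₀).support) :
    pre E π T {strictTransformIdeal π (T.sup id) K₀} = {K₀} := by
  ext K
  simp only [mem_pre_iff, Finset.mem_singleton]
  constructor
  · rintro ⟨hK, heq⟩
    have hxK : x' ∈ (strictTransformIdeal π (T.sup id) K).support := by rw [heq]; exact hx'
    exact eq_of_strictTransformIdeal_eq hE hT hπ (mem_sheaves_iff.mp hK) (mem_sheaves_iff.mp hK₀) hxK heq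
  · rintro rfl
    exact ⟨hK₀, rfl⟩

/-- **The exponent of a strict transform** (at any of its points) is the old exponent.
[cite: Kollar2007, (3.111) Step 3] -/
theorem expOf_transformExp_strictTransform {K₀ : X.IdealSheafData} (hK₀ : K₀ ∈ sheaves E) {x' : X'}
    (hx' : x' ∈ (strictTransformIdeal π (T.sup id) K₀).support) :
    expOf (transformExp E π T m) (strictTransformIdeal π (T.sup id) K₀) = expOf E K₀ := by
  classical
  have hne : (T.sup id).comap π ∉ ({strictTransformIdeal π (T.sup id) K₀} : Finset X'.IdealSheafData) := by
    rw [Finset.mem_singleton]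
    intro h
    have hx'F : x' ∈ ((T.sup id).comap π).support := by rw [h]; exact hx'
    exact strictTransformIdeal_ne_comap hE hT hπ (mem_sheaves_iff.mp hK₀) hx'F h.symm
  rw [expOf, weightOf_transformExp, pre_singleton_strictTransform hE hT hπ hK₀ hx', if_neg hne, add_zero]
  rfl

omit [IsLocallyNoetherian X] hE hT hπ in
/-- A divisor of the transformed list with a point is the exceptional divisor or the strict transform
of an old divisor passing through the image point. [folklore] -/
theorem eq_comap_or_exists_eq_strictTransform {G : X'.IdealSheafData} (hG : G ∈ sheaves (transformExp E π T m))
    {x' : X'} (hx' : x' ∈ G.support) :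
    G = (T.sup id).comap π ∨
      ∃ K₀ ∈ sheaves E, strictTransformIdeal π (T.sup id) K₀ = G ∧ π x' ∈ K₀.support := by
  rcases mem_sheaves_transformExp_iff.mp hG with ⟨K₀, hK₀, rfl⟩ | h
  · exact Or.inr ⟨K₀, hK₀, rfl, mem_support_of_mem_support_strictTransformIdeal hx'⟩
  · exact Or.inl h

/-- The total transform of the monomial ideal is the monomial ideal of `transformExp E π T 0`.
[cite: Kollar2007, (3.111) Step 3] -/
theorem comap_monomialIdeal_eq_transformExp :
    (monomialIdeal E).comap π = monomialIdeal (transformExp E π T 0) := by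
  rw [comap_monomialIdeal hE hT hπ, transformExp, monomialIdeal_append, monomialIdeal_singleton,
    Nat.sub_zero, mul_comm]

end Exponents

/-! ## One step: blowing up a well-chosen bad pair -/

section Step

variable {X : Scheme.{u}} [IsLocallyNoetherian X] {A B : List (X.IdealSheafData × ℕ)}

/-- **Classification of the bad pairs after the blow-up of the stratum of a bad pair `(K, L)` chosen
with `a_K − b_K = M` maximal and `b_L − a_L` maximal among the bad partners of `K`**: a new bad pair
either has value `< M`, or is the pair of strict transforms of an old bad pair other than `(K, L)`, with
the same value. [folklore] -/
theorem step_classify (hE : HasSNC (boundaryOf A)) (hAB : boundaryOf A = boundaryOf B)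
    {K L : X.IdealSheafData} (hKL : (K, L) ∈ badPairs A B)
    (hKM : expOf A K - expOf B K = maxVal A B)
    (hLmax : ∀ H ∈ sheaves B, (K, H) ∈ badPairs A B → expOf B H - expOf A H ≤ expOf B L - expOf A L)
    {T : Finset X.IdealSheafData} (hTKL : ∀ G, G ∈ T ↔ G = K ∨ G = L)
    {X' : Scheme.{u}} {π : X' ⟶ X} (hπ : IsBlowup π (T.sup id))
    (p' : X'.IdealSheafData × X'.IdealSheafData)
    (hp' : p' ∈ badPairs (transformExp A π T 0) (transformExp B π T 0)) :
    value (transformExp A π T 0) (transformExp B π T 0) p' < maxVal A B ∨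
      ∃ p ∈ badPairs A B, p ≠ (K, L) ∧
        p' = (strictTransformIdeal π (T.sup id) p.1, strictTransformIdeal π (T.sup id) p.2) ∧
        value (transformExp A π T 0) (transformExp B π T 0) p' = value A B p := by
  classical
  set F : X'.IdealSheafData := (T.sup id).comap π with hFdef
  have hEB : HasSNC (boundaryOf B) := hAB ▸ hE
  obtain ⟨hKA, hLB, hK1, hL1, -⟩ := mem_badPairs_iff.mp hKL
  replace hKA : K ∈ sheaves A := hKA
  replace hLB : L ∈ sheaves B := hLB
  replace hK1 : expOf B K < expOf A K := hK1
  replace hL1 : expOf A L < expOf B L := hL1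
  have hKT : K ∈ T := (hTKL K).mpr (Or.inl rfl)
  have hLT : L ∈ T := (hTKL L).mpr (Or.inr rfl)
  have hSAB : sheaves A = sheaves B := sheaves_eq_of_boundaryOf_eq hAB
  have hTA : ∀ G ∈ T, G ∈ boundaryOf A := by
    intro G hG
    rcases (hTKL G).mp hG with rfl | rfl
    · exact mem_sheaves_iff.mp hKA
    · exact mem_sheaves_iff.mp (hSAB ▸ hLB)
  have hTB : ∀ G ∈ T, G ∈ boundaryOf B := fun G hG => hAB ▸ hTA G hG
  have hKneL : K ≠ L := by rintro rfl; omega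
  have hvalKL : expOf B L - expOf A L ≤ expOf A K - expOf B K := by
    have h := value_le_maxVal hKL
    rw [value, ← hKM] at h
    exact le_of_max_le_right h
  have hTeq : T = insert K {L} := by
    ext G
    rw [hTKL G, Finset.mem_insert, Finset.mem_singleton]
  have hwA : weightOf A T = expOf A K + expOf A L := by
    rw [hTeq, weightOf_insert A (by rwa [Finset.mem_singleton])]
    rfl
  have hwB : weightOf B T = expOf B K + expOf B L := by
    rw [hTeq, weightOf_insert B (by rwa [Finset.mem_singleton])]
    rfl
  -- unpack the new bad pair
  obtain ⟨hG, hH, hGlt, hHlt, x', hxG, hxH⟩ := mem_badPairs_iff.mp hp'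
  obtain ⟨G, H⟩ := p'
  simp only at hG hH hGlt hHlt hxG hxH ⊢
  -- exponents of the exceptional divisor
  have hexpF : ∀ {y : X'}, y ∈ F.support →
      expOf (transformExp A π T 0) F = expOf A K + expOf A L ∧
        expOf (transformExp B π T 0) F = expOf B K + expOf B L := fun hy =>
    ⟨by rw [expOf_transformExp_comap hE hTA hπ hy, hwA, Nat.sub_zero],
     by rw [expOf_transformExp_comap hEB hTB hπ hy, hwB, Nat.sub_zero]⟩
  -- `H` is not the exceptional divisor
  have hHF : H ≠ F := by
    intro hHF
    rw [hHF] at hHlt hxH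
    obtain ⟨hA', hB'⟩ := hexpF hxH
    rw [hA', hB'] at hHlt
    omega
  -- so `H` is a strict transform
  obtain ⟨H₀, hH₀, hH₀eq, hxH₀⟩ : ∃ H₀ ∈ sheaves B, strictTransformIdeal π (T.sup id) H₀ = H ∧
      π x' ∈ H₀.support := by
    rcases eq_comap_or_exists_eq_strictTransform hH hxH with h | h
    · exact absurd h hHF
    · exact h
  have hexpH : expOf (transformExp A π T 0) H = expOf A H₀ ∧ expOf (transformExp B π T 0) H = expOf B H₀ := by
    rw [← hH₀eq] at hxH ⊢
    exact ⟨expOf_transformExp_strictTransform hE hTA hπ (hSAB ▸ hH₀) hxH,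
      expOf_transformExp_strictTransform hEB hTB hπ hH₀ hxH⟩
  by_cases hGF : G = F
  · -- the new pair is `(F, H₀')`: its value is `< M`
    left
    rw [hGF] at hGlt hxG ⊢
    obtain ⟨hAF, hBF⟩ := hexpF hxG
    -- `(K, H₀)` is an old bad pair, so `b_{H₀} - a_{H₀} ≤ b_L - a_L`
    have hxK : π x' ∈ K.support := by
      have h : π x' ∈ (T.sup id).support := by
        have h' : x' ∈ (F.support : Set X') := hxG
        rw [hFdef, Scheme.IdealSheafData.support_comap] at h'
        exact h'
      exact (mem_support_finsetSup_iff T _).mp h K hKT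
    have hKH₀ : (K, H₀) ∈ badPairs A B := by
      refine mem_badPairs_iff.mpr ⟨hKA, hH₀, hK1, ?_, π x', hxK, hxH₀⟩
      rw [hexpH.1, hexpH.2] at hHlt
      exact hHlt
    have hle := hLmax H₀ hH₀ hKH₀
    rw [value]
    simp only
    rw [hAF, hBF, hexpH.1, hexpH.2]
    rw [hAF, hBF] at hGlt
    omega
  · -- the new pair is `(G₀', H₀')` for an old bad pair `(G₀, H₀) ≠ (K, L)`
    right
    obtain ⟨G₀, hG₀, hG₀eq, hxG₀⟩ : ∃ G₀ ∈ sheaves A, strictTransformIdeal π (T.sup id) G₀ = G ∧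
        π x' ∈ G₀.support := by
      rcases eq_comap_or_exists_eq_strictTransform hG hxG with h | h
      · exact absurd h hGF
      · exact h
    have hexpG : expOf (transformExp A π T 0) G = expOf A G₀ ∧ expOf (transformExp B π T 0) G = expOf B G₀ := by
      rw [← hG₀eq] at hxG ⊢
      exact ⟨expOf_transformExp_strictTransform hE hTA hπ hG₀ hxG,
        expOf_transformExp_strictTransform hEB hTB hπ (hSAB ▸ hG₀) hxG⟩
    refine ⟨(G₀, H₀), ?_, ?_, ?_, ?_⟩
    · refine mem_badPairs_iff.mpr ⟨hG₀, hH₀, ?_, ?_, π x', hxG₀, hxH₀⟩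
      · rw [hexpG.1, hexpG.2] at hGlt; exact hGlt
      · rw [hexpH.1, hexpH.2] at hHlt; exact hHlt
    · -- `(G₀, H₀) ≠ (K, L)`: the strict transforms of `K` and `L` have no common point
      intro heq
      simp only [Prod.mk.injEq] at heq
      obtain ⟨rfl, rfl⟩ := heq
      have hxT : π x' ∈ (T.sup id).support :=
        (mem_support_finsetSup_iff T _).mpr fun G' hG' => by
          rcases (hTKL G').mp hG' with rfl | rfl
          · exact hxG₀
          · exact hxH₀
      have hxF : x' ∈ F.support := by
        show x' ∈ (F.support : Set X')
        rw [hFdef, Scheme.IdealSheafData.support_comap]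
        exact hxT
      obtain ⟨G', hG'T, hG'⟩ := exists_not_mem_support_strictTransformIdeal hE hTA hπ hxF
      rcases (hTKL G').mp hG'T with rfl | rfl
      · exact hG' (hG₀eq ▸ hxG)
      · exact hG' (hH₀eq ▸ hxH)
    · simp only [Prod.mk.injEq]
      exact ⟨hG₀eq.symm, hH₀eq.symm⟩
    · rw [value, value]
      simp only
      rw [hexpG.1, hexpG.2, hexpH.1, hexpH.2]

/-- **The blow-up step.** If some bad pair attains the maximal value `M` on its `A`-side, blowing up
the stratum of a well-chosen bad pair yields transformed exponent lists on the (chosen) blow-up with: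
regular centre inside the cosupport, the same snc boundary for both lists, the total transforms of the
two monomial ideals, and a lexicographically smaller measure. [cite: Kollar2007, (3.111) Step 3] -/
theorem exists_step (hE : HasSNC (boundaryOf A)) (hAB : boundaryOf A = boundaryOf B)
    (hex : ∃ p ∈ badPairs A B, expOf A p.1 - expOf B p.1 = maxVal A B) :
    ∃ (C : X.IdealSheafData) (A' B' : List ((blowup C).IdealSheafData × ℕ)),
      Scheme.IsRegular C.subscheme ∧
      (C.support : Set X) ⊆ (monomialIdeal A ⊔ monomialIdeal B).support ∧
      boundaryOf A' = boundaryOf B' ∧ HasSNC (boundaryOf A') ∧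
      (monomialIdeal A).comap (blowup.π C) = monomialIdeal A' ∧
      (monomialIdeal B).comap (blowup.π C) = monomialIdeal B' ∧
      (maxVal A' B' < maxVal A B ∨ (maxVal A' B' = maxVal A B ∧ numMax A' B' < numMax A B)) := by
  classical
  obtain ⟨p₀, hp₀, hp₀M⟩ := hex
  set K := p₀.1 with hKdef
  -- choose `L` maximizing `b_L - a_L` among the bad partners of `K`
  set partners := (badPairs A B).filter fun p => p.1 = K with hpartners
  have hne : partners.Nonempty := ⟨p₀, Finset.mem_filter.mpr ⟨hp₀, rfl⟩⟩
  obtain ⟨p₁, hp₁, hp₁max⟩ := Finset.exists_max_image partners (fun p => expOf B p.2 - expOf A p.2) hne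
  obtain ⟨hp₁bad, hp₁K⟩ := Finset.mem_filter.mp hp₁
  set L := p₁.2 with hLdef
  have hKL : (K, L) ∈ badPairs A B := by
    have : p₁ = (K, L) := Prod.ext hp₁K rfl
    rwa [this] at hp₁bad
  have hLmax : ∀ H ∈ sheaves B, (K, H) ∈ badPairs A B → expOf B H - expOf A H ≤ expOf B L - expOf A L :=
    fun H _ hKH => hp₁max (K, H) (Finset.mem_filter.mpr ⟨hKH, rfl⟩)
  have hKM : expOf A K - expOf B K = maxVal A B := hp₀M
  have hvalKL : value A B (K, L) = maxVal A B := by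
    refine le_antisymm (value_le_maxVal hKL) ?_
    rw [value, ← hKM]
    exact le_max_left _ _
  obtain ⟨hKA, hLB, hbad⟩ := mem_badPairs_iff.mp hKL
  replace hKA : K ∈ sheaves A := hKA
  replace hLB : L ∈ sheaves B := hLB
  replace hbad : IsBadPair A B K L := hbad
  have hSAB : sheaves A = sheaves B := sheaves_eq_of_boundaryOf_eq hAB
  set T : Finset X.IdealSheafData := {K, L} with hTdef
  have hTA : ∀ G ∈ T, G ∈ boundaryOf A := by
    intro G hG
    rcases Finset.mem_insert.mp hG with rfl | hG
    · exact mem_sheaves_iff.mp hKA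
    · rw [Finset.mem_singleton.mp hG]; exact mem_sheaves_iff.mp (hSAB ▸ hLB)
  have hEB : HasSNC (boundaryOf B) := hAB ▸ hE
  have hTB : ∀ G ∈ T, G ∈ boundaryOf B := fun G hG => hAB ▸ hTA G hG
  set C : X.IdealSheafData := T.sup id with hC
  have hπ : IsBlowup (blowup.π C) (T.sup id) := blowup.isBlowup C
  refine ⟨C, transformExp A (blowup.π C) T 0, transformExp B (blowup.π C) T 0,
    hE.isRegular_subscheme_finsetSup T hTA, ?_, ?_, hasSNC_boundaryOf_transformExp hE hTA hπ 0,
    comap_monomialIdeal_eq_transformExp hE hTA hπ, comap_monomialIdeal_eq_transformExp hEB hTB hπ, ?_⟩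
  · -- the centre lies in the cosupport
    intro x hx
    have hx' := (mem_support_finsetSup_iff T x).mp hx
    exact mem_support_sup_of_isBadPair hKA hLB hbad (hx' K (Finset.mem_insert_self K _))
      (hx' L (Finset.mem_insert_of_mem (Finset.mem_singleton_self L)))
  · rw [boundaryOf_transformExp, boundaryOf_transformExp, hAB]
  · -- the measure drops
    set A' := transformExp A (blowup.π C) T 0 with hA'
    set B' := transformExp B (blowup.π C) T 0 with hB'
    have hTKL : ∀ G, G ∈ T ↔ G = K ∨ G = L := fun G => by
      rw [hTdef, Finset.mem_insert, Finset.mem_singleton]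
    have hcl := step_classify hE hAB hKL hKM hLmax hTKL hπ
    -- every new value is `≤ M`
    have hle : maxVal A' B' ≤ maxVal A B := by
      refine Finset.sup_le fun p' hp' => ?_
      rcases hcl p' hp' with h | ⟨p, hp, -, -, hv⟩
      · exact h.le
      · rw [hv]; exact value_le_maxVal hp
    rcases hle.lt_or_eq with hlt | heq
    · exact Or.inl hlt
    · refine Or.inr ⟨heq, ?_⟩
      -- the new pairs of value `M` come from old pairs of value `M` other than `(K, L)`
      let st : X.IdealSheafData × X.IdealSheafData → (blowup C).IdealSheafData × (blowup C).IdealSheafData :=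
        fun p => (strictTransformIdeal (blowup.π C) (T.sup id) p.1, strictTransformIdeal (blowup.π C) (T.sup id) p.2)
      have hsub : (badPairs A' B').filter (fun p' => value A' B' p' = maxVal A' B') ⊆
          (((badPairs A B).filter fun p => value A B p = maxVal A B).erase (K, L)).image st := by
        intro p' hp'
        obtain ⟨hp'bad, hp'v⟩ := Finset.mem_filter.mp hp'
        rcases hcl p' hp'bad with h | ⟨p, hp, hpne, hpeq, hv⟩
        · rw [hp'v, heq] at h; exact absurd h (lt_irrefl _)
        · refine Finset.mem_image.mpr ⟨p, Finset.mem_erase.mpr ⟨hpne, Finset.mem_filter.mpr ⟨hp, ?_⟩⟩, hpeq.symm⟩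
          rw [← hv, hp'v, heq]
      rw [numMax, numMax]
      calc ((badPairs A' B').filter fun p' => value A' B' p' = maxVal A' B').card
          ≤ ((((badPairs A B).filter fun p => value A B p = maxVal A B).erase (K, L)).image st).card :=
            Finset.card_le_card hsub
        _ ≤ (((badPairs A B).filter fun p => value A B p = maxVal A B).erase (K, L)).card :=
            Finset.card_image_le
        _ < ((badPairs A B).filter fun p => value A B p = maxVal A B).card :=
            Finset.card_erase_lt_of_mem (Finset.mem_filter.mpr ⟨hKL, hvalKL⟩)

end Step

end MonomialCleanup

end Summit.ResolutionOfSingularities.ResolutionOfSingularities.Theorems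

end
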